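import Mathlib
import Literature.AlgebraicGeometry.StanleyReisner.StanleyReisnerScheme

/-!
# Venture HSemireg — (S5) OBSTRUCTION LOCUS away from secant type, VIII: the LOCAL LEMMA L1 of the SR design in the
# kernel, bricks 1–2 — the first syzygies of `m_k = ∏_{l ≠ k} x_l` (L1 (pd)) and `Hom_R(I_W, R/I_W) = ⊕_k Ann(x_k)`

HONEST FRAMING.  Part of the Lean side of the computation cell `pub-hsemireg` (track «S4-PUSH» (ii), seat s4-prove-2).
Files I–VII of this series type (S5)'s closed forms with the geometric inputs as NAMED HYPOTHESIS SHAPES; the shape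
(H-arr) («`ob_F(ξ) = 0` ⟹ every governing branch follows `ξ`») rests, for literal ideal sheaves, on the LOCAL LEMMA L1 of
general-structure/eng1/g2/G2-REDUCIBLE-POINT-THEOREM.md §2 (two paper proofs — gs-eng-1 g2, deform-ring2 EXT-NOTE §6 — and
four codes, n ≤ 7).  This file starts moving L1 from paper to kernel, for every `n` and over an arbitrary commutative
ring `K` (a DOMAIN where cancellation is used — in particular `K = k[y_1, …, y_m]`, which is the «extra free variables»
form of L1, Remark (a) loc. cit.; completion is NOT covered, localisation is file X's `isLocalizedModule_normalModule`),
as plain commutative algebra in `R = MvPolynomial (Fin n) K`.  SCOPE (source-author read, deform-ring2 g202): this is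
the ONE-BLOCK model `K_S` (`S = [n]`) of EXT-NOTE §6.0 — every germ of a SINGLE translate `W + t`; the CROSSING germs
`M(S_1, …, S_r)`, `r ≥ 2`, of a union of `m ≥ 2` translates (`n ≥ 4`, (GEN)) are §6.B «every block model» ON PAPER only
(tensor product of the block resolutions + Künneth) and are NOT covered here.  Content: part (pd) — the first syzygies
of the generators `m_k = x_1 ⋯ x_n / x_k` of `I_W = (m_1, …, m_n) = ⋂_{i<j} (x_i, x_j)` — and the first half of part (i)
— an `R`-linear map `I_W → R/I_W` is the same as a tuple `(ν_k) ∈ (R/I_W)ⁿ` of values on the generators with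
`x_k ν_k = 0` for every `k` (the printed «`x_1 ν_1 = x_k ν_k` for all `k`, and the common value is `0`»).  Nothing here
constructs a variety or a sheaf; nothing here says that HC / HC_CM / HC_AV holds; the only Literature import is the
Stanley–Reisner monomial bookkeeping (`prod_X_eq_monomial_indicator`, `indicator_one_le_iff`), no named fact.

* `cofactor k = ∏_{l ≠ k} X l`, `X_mul_cofactor` (`x_k m_k = x_1 ⋯ x_n`), `X_dvd_cofactor` (`x_j ∣ m_k`, `j ≠ k`),
  `not_X_dvd_cofactor` (`x_k ∤ m_k`, via `MvPolynomial.X_prime`).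
* `sum_mul_cofactor_eq_zero_iff` — **L1 (pd), first syzygies**: `Σ_k r_k m_k = 0 ⟺ r_k = x_k s_k` for some `s` with
  `Σ_k s_k = 0`.  (Printed proof, loc. cit.: «reducing mod `x_k` kills every term but `r_k m_k`, and `m_k` is a
  non-zero-divisor mod `x_k`, so `x_k ∣ r_k`; then `(Σ s_k)·P = 0`».)  Equivalently the syzygy module is the image of
  `{s : Σ s_k = 0} ≅ R^{n−1}` under `s ↦ (x_k s_k)_k` (`syzygy_iff_mem_range`), injectively (`smulX_injective`) — the
  Hilbert–Burch shape `0 → R^{n−1} → R^n → I_W → 0`, whence `pd_R I_W = 1`.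
* `srDesignIdeal = (m_1, …, m_n)`, `mem_srDesignIdeal_iff` — MONOMIAL IDEAL: `f ∈ I_W` iff every exponent vector in
  the support of `f` vanishes in at most one coordinate (`MvPolynomial.mem_ideal_span_monomial_image`).
* `X_smul_eq_zero_of_forall_X_smul_eq` — **L1 (i), step A**: if `x_j ν_j = x_k ν_k` in `R/I_W` for all `j, k`, then
  every `x_k ν_k = 0` (printed: «the common value is divisible by every `x_k` monomial by monomial — there are no such
  monomials in `R/I`»; here: a monomial of `x_k g` with a zero coordinate `b` is untouched by `x_b g'`, so it lies in
  `I_W`).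
* `genMap` (`r ↦ Σ r_k m_k : Rⁿ ↠ I_W`), `tupleMap`, `homOfTuple`, `X_smul_apply_gen_eq_zero`, `hom_ext_gen`,
  **`evalGenEquiv`** — **L1 (i), first half**: evaluation at the generators is an `R`-linear isomorphism
  `Hom_R(I_W, R/I_W) ≃ {ν ∈ (R/I_W)ⁿ : x_k ν_k = 0 ∀ k} = ⊕_k Ann_{R/I_W}(x_k)`.
Next bricks (not here): `Ann_{R/I_W}(x_k) = (m_{jk} : j ≠ k)/I_W ≅ ⊕_{j ≠ k} R/(x_j, x_k)·E_{kj}` (second half of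
L1 (i): `N′_W = ⊕ ν_* N_{B_jk}`) and L1 (ii) `δ : Hom(I, R/I) ⥲ Ext¹(I, I)`.
References (dictionary only): G2-REDUCIBLE-POINT-THEOREM.md §2; EXT-NOTE.md §6.A–B.  Nearest prior art IN PRINT: (pd) is
an instance of the Hilbert–Burch theorem (Eisenbud, The Geometry of Syzygies, Thm. 3.2; Northcott, Finite Free Resolutions)
— proved here directly from `MvPolynomial.X_prime`, Mathlib having no Hilbert–Burch; (i) is the special case «Δ = the
(n−3)-skeleton of the (n−1)-simplex» of the Stanley–Reisner `T¹` calculus (Altmann–Christophersen 2004/2010, named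
loc. cit.).
-/

open scoped BigOperators
open MvPolynomial Finset
open Literature.AlgebraicGeometry.StanleyReisner (prod_X_eq_monomial_indicator indicator_one_le_iff)

namespace Summit.Ventures.HSemireg.ObstructionLocus

variable {K : Type*} [CommRing K] {n : ℕ}

/-- `m_k = ∏_{l ≠ k} x_l`, the square-free monomial of degree `n − 1` omitting `x_k`; `I_W = (m_1, …, m_n)`. -/
noncomputable def cofactor (k : Fin n) : MvPolynomial (Fin n) K := ∏ l ∈ univ.erase k, X l

/-- `x_k · m_k = P := x_1 ⋯ x_n`. -/
theorem X_mul_cofactor (k : Fin n) : X k * cofactor k = ∏ l, (X l : MvPolynomial (Fin n) K) := by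
  rw [cofactor, Finset.mul_prod_erase univ (fun l => (X l : MvPolynomial (Fin n) K)) (mem_univ k)]

/-- `x_j ∣ m_k` for `j ≠ k`. -/
theorem X_dvd_cofactor {j k : Fin n} (h : j ≠ k) : (X j : MvPolynomial (Fin n) K) ∣ cofactor k :=
  Finset.dvd_prod_of_mem _ (mem_erase.2 ⟨h, mem_univ j⟩)

/-- `x_k ∤ m_k` (`x_k` is prime and divides no `x_l`, `l ≠ k`). -/
theorem not_X_dvd_cofactor [IsDomain K] (k : Fin n) : ¬ (X k : MvPolynomial (Fin n) K) ∣ cofactor k := by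
  intro h
  rw [cofactor, (X_prime (R := K) (σ := Fin n) (i := k)).dvd_finsetProd_iff] at h
  obtain ⟨l, hl, hkl⟩ := h
  rw [X_dvd_X] at hkl
  exact (mem_erase.1 hl).1 hkl.symm

/-- `P = x_1 ⋯ x_n ≠ 0`. -/
theorem prod_X_ne_zero [IsDomain K] : (∏ l, (X l : MvPolynomial (Fin n) K)) ≠ 0 :=
  Finset.prod_ne_zero_iff.2 fun l _ => X_ne_zero l

/-- **Lemma L1 (pd): the first syzygies of `(m_1, …, m_n)`**, every `n`, every domain `K`.
`Σ_k r_k m_k = 0` iff `r_k = x_k s_k` for some `s` with `Σ_k s_k = 0`. -/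
theorem sum_mul_cofactor_eq_zero_iff [IsDomain K] (r : Fin n → MvPolynomial (Fin n) K) :
    ∑ k, r k * cofactor k = 0 ↔
      ∃ s : Fin n → MvPolynomial (Fin n) K, (∀ k, r k = X k * s k) ∧ ∑ k, s k = 0 := by
  constructor
  · intro h
    have hdvd : ∀ k, (X k : MvPolynomial (Fin n) K) ∣ r k := by
      intro k
      have h1 : r k * cofactor k = -∑ l ∈ univ.erase k, r l * cofactor l := by
        rw [← Finset.add_sum_erase univ (fun l => r l * cofactor l) (mem_univ k)] at h
        linear_combination h
      have h2 : (X k : MvPolynomial (Fin n) K) ∣ r k * cofactor k := by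
        rw [h1]
        exact (Finset.dvd_sum fun l hl =>
          dvd_mul_of_dvd_right (X_dvd_cofactor (mem_erase.1 hl).1.symm) _).neg_right
      rcases X_dvd_mul_iff.1 h2 with h3 | h3
      · exact h3
      · exact absurd h3 (not_X_dvd_cofactor k)
    choose s hs using hdvd
    refine ⟨s, hs, ?_⟩
    have hP : (∑ k, s k) * ∏ l, (X l : MvPolynomial (Fin n) K) = 0 := by
      rw [Finset.sum_mul, ← h]
      refine Finset.sum_congr rfl fun k _ => ?_
      rw [hs k, ← X_mul_cofactor k]
      ring
    exact (mul_eq_zero.1 hP).resolve_right prod_X_ne_zero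
  · rintro ⟨s, hs, hsum⟩
    calc ∑ k, r k * cofactor k = ∑ k, s k * (X k * cofactor k) :=
          Finset.sum_congr rfl fun k _ => by rw [hs k]; ring
      _ = (∑ k, s k) * ∏ l, (X l : MvPolynomial (Fin n) K) := by
          rw [Finset.sum_mul]
          exact Finset.sum_congr rfl fun k _ => by rw [X_mul_cofactor]
      _ = 0 := by rw [hsum, zero_mul]

/-- The Hilbert–Burch map `s ↦ (x_k s_k)_k` on coefficient vectors. -/
noncomputable def smulX (s : Fin n → MvPolynomial (Fin n) K) : Fin n → MvPolynomial (Fin n) K :=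
  fun k => X k * s k

/-- `s ↦ (x_k s_k)_k` is injective (`R` is a domain). -/
theorem smulX_injective : Function.Injective (smulX (K := K) (n := n)) := by
  intro s t h
  funext k
  have := congr_fun h k
  exact (X_mul_cancel_left_iff (i := k)).1 this

/-- **L1 (pd), module form.**  The syzygies of `(m_1, …, m_n)` are EXACTLY the images `(x_k s_k)_k` of the vectors
`s` with `Σ s_k = 0` (a free module of rank `n − 1`, spanned by `f_k = e_1 − e_k`, whose images are the Hilbert–Burch
columns `x_1 e_1 − x_k e_k`); so `0 → R^{n−1} → R^n → I_W → 0` is a free resolution and `pd_R I_W ≤ 1`. -/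
theorem syzygy_iff_mem_image [IsDomain K] (r : Fin n → MvPolynomial (Fin n) K) :
    ∑ k, r k * cofactor k = 0 ↔
      r ∈ smulX '' {s : Fin n → MvPolynomial (Fin n) K | ∑ k, s k = 0} := by
  rw [sum_mul_cofactor_eq_zero_iff]
  constructor
  · rintro ⟨s, hs, hsum⟩
    exact ⟨s, hsum, funext fun k => (hs k).symm⟩
  · rintro ⟨s, hsum, rfl⟩
    exact ⟨s, fun k => rfl, hsum⟩

/-! ## `I_W` as a monomial ideal -/

variable (K n) in
/-- `I_W = (m_1, …, m_n) = ⋂_{i<j} (x_i, x_j)`: the ideal of the SR design `W = ⋃_{i<j} B_ij ⊂ 𝔸ⁿ`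
(`B_ij = V(x_i, x_j)`). -/
noncomputable def srDesignIdeal : Ideal (MvPolynomial (Fin n) K) :=
  Ideal.span (Set.range (cofactor (K := K) (n := n)))

/-- The generators lie in the ideal. -/
theorem cofactor_mem (k : Fin n) : cofactor k ∈ srDesignIdeal K n := Ideal.subset_span ⟨k, rfl⟩

/-- `m_k` is the monomial with exponent the indicator of `[n] ∖ k`. -/
theorem cofactor_eq_monomial (k : Fin n) :
    (cofactor k : MvPolynomial (Fin n) K) = monomial (Finsupp.indicator (univ.erase k) fun _ _ => 1) 1 :=
  prod_X_eq_monomial_indicator K (univ.erase k)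

/-- `I_W` in Mathlib's monomial-ideal format. -/
theorem srDesignIdeal_eq_span_monomial :
    srDesignIdeal K n = Ideal.span ((fun e => monomial e (1 : K)) ''
      Set.range (fun k : Fin n => Finsupp.indicator (univ.erase k) fun _ _ => (1 : ℕ))) := by
  unfold srDesignIdeal
  congr 1
  ext m
  constructor
  · rintro ⟨k, rfl⟩
    exact ⟨_, ⟨k, rfl⟩, (cofactor_eq_monomial k).symm⟩
  · rintro ⟨e, ⟨k, rfl⟩, rfl⟩
    exact ⟨k, cofactor_eq_monomial k⟩

/-- **Membership in `I_W` is read off the monomials**: `f ∈ I_W` iff every exponent vector occurring in `f` is non-zero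
at all coordinates but (at most) one. -/
theorem mem_srDesignIdeal_iff {f : MvPolynomial (Fin n) K} :
    f ∈ srDesignIdeal K n ↔ ∀ a ∈ f.support, ∃ k : Fin n, univ.erase k ⊆ a.support := by
  rw [srDesignIdeal_eq_span_monomial, mem_ideal_span_monomial_image]
  refine forall₂_congr fun a _ => ⟨?_, ?_⟩
  · rintro ⟨e, ⟨k, rfl⟩, hle⟩
    exact ⟨k, indicator_one_le_iff.1 hle⟩
  · rintro ⟨k, hk⟩
    exact ⟨_, ⟨k, rfl⟩, indicator_one_le_iff.2 hk⟩

/-! ## L1 (i), step A: the common value `x_k ν_k` vanishes -/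

/-- The `R`-action on `R/I_W` in terms of representatives. -/
theorem smul_mk (r g : MvPolynomial (Fin n) K) :
    r • Ideal.Quotient.mk (srDesignIdeal K n) g = Ideal.Quotient.mk (srDesignIdeal K n) (r * g) := by
  rw [← smul_eq_mul, ← Ideal.Quotient.mk_eq_mk, ← Ideal.Quotient.mk_eq_mk, Submodule.Quotient.mk_smul]

/-- **L1 (i), step A.**  If `x_j ν_j = x_k ν_k` in `R/I_W` for all `j, k`, then `x_k ν_k = 0` for every `k`. -/
theorem X_smul_eq_zero_of_forall_X_smul_eq (ν : Fin n → MvPolynomial (Fin n) K ⧸ srDesignIdeal K n)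
    (h : ∀ j k : Fin n, (X j : MvPolynomial (Fin n) K) • ν j = (X k : MvPolynomial (Fin n) K) • ν k)
    (k : Fin n) :
    (X k : MvPolynomial (Fin n) K) • ν k = 0 := by
  classical
  obtain ⟨g, hg⟩ := Ideal.Quotient.mk_surjective (ν k)
  rw [← hg, smul_mk, Ideal.Quotient.eq_zero_iff_mem, mem_srDesignIdeal_iff]
  intro a ha
  by_cases hfull : ∀ l, l ∈ a.support
  · exact ⟨k, fun l _ => hfull l⟩
  push Not at hfull
  obtain ⟨b, hb⟩ := hfull
  obtain ⟨g', hg'⟩ := Ideal.Quotient.mk_surjective (ν b)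
  have hmem : X k * g - X b * g' ∈ srDesignIdeal K n := by
    rw [← Ideal.Quotient.eq, ← smul_mk, ← smul_mk, hg, hg']
    exact h k b
  have hcoeff : coeff a (X k * g - X b * g') = coeff a (X k * g) := by
    rw [coeff_sub, coeff_X_mul' a b g', if_neg hb, sub_zero]
  have ha' : a ∈ (X k * g - X b * g').support := by
    rw [mem_support_iff, hcoeff]
    exact mem_support_iff.1 ha
  exact mem_srDesignIdeal_iff.1 hmem a ha'

/-! ## L1 (i), first half: `Hom_R(I_W, R/I_W)` = tuples of generator values killed by the `x_k` -/

/-- The generator map `Ψ : Rⁿ → I_W`, `r ↦ Σ_k r_k m_k`. -/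
noncomputable def genMap :
    (Fin n → MvPolynomial (Fin n) K) →ₗ[MvPolynomial (Fin n) K] srDesignIdeal K n :=
  ∑ k, (LinearMap.proj k).smulRight ⟨cofactor k, cofactor_mem k⟩

/-- `Ψ r = Σ r_k m_k`. -/
theorem genMap_apply_coe (r : Fin n → MvPolynomial (Fin n) K) :
    (genMap r : MvPolynomial (Fin n) K) = ∑ k, r k * cofactor k := by
  simp [genMap, LinearMap.sum_apply, LinearMap.smulRight_apply]

/-- `Ψ e_k = m_k`. -/
theorem genMap_single (k : Fin n) :
    genMap (Pi.single k (1 : MvPolynomial (Fin n) K)) = ⟨cofactor k, cofactor_mem k⟩ := by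
  apply Subtype.ext
  rw [genMap_apply_coe, Finset.sum_eq_single k]
  · simp
  · intro l _ hl; simp [hl]
  · intro h; exact absurd (mem_univ k) h

/-- `Ψ` is onto `I_W`. -/
theorem genMap_surjective : Function.Surjective (genMap (K := K) (n := n)) := by
  rintro ⟨f, hf⟩
  obtain ⟨c, hc⟩ := Ideal.mem_span_range_iff_exists_fun.1 hf
  exact ⟨c, Subtype.ext (by rw [genMap_apply_coe]; exact hc)⟩

/-- The tuple map `Φ_ν : Rⁿ → R/I_W`, `r ↦ Σ_k r_k ν_k`. -/
noncomputable def tupleMap (ν : Fin n → MvPolynomial (Fin n) K ⧸ srDesignIdeal K n) :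
    (Fin n → MvPolynomial (Fin n) K) →ₗ[MvPolynomial (Fin n) K] MvPolynomial (Fin n) K ⧸ srDesignIdeal K n :=
  ∑ k, (LinearMap.proj k).smulRight (ν k)

/-- `Φ_ν r = Σ r_k ν_k`. -/
theorem tupleMap_apply (ν : Fin n → MvPolynomial (Fin n) K ⧸ srDesignIdeal K n)
    (r : Fin n → MvPolynomial (Fin n) K) : tupleMap ν r = ∑ k, r k • ν k := by
  simp [tupleMap, LinearMap.sum_apply, LinearMap.smulRight_apply]

/-- By L1 (pd): a syzygy of the `m_k` kills every tuple annihilated by the `x_k`. -/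
theorem ker_genMap_le_ker_tupleMap [IsDomain K] {ν : Fin n → MvPolynomial (Fin n) K ⧸ srDesignIdeal K n}
    (hν : ∀ k, (X k : MvPolynomial (Fin n) K) • ν k = 0) :
    LinearMap.ker (genMap (K := K) (n := n)) ≤ LinearMap.ker (tupleMap ν) := by
  intro r hr
  rw [LinearMap.mem_ker] at hr ⊢
  have h0 : ∑ k, r k * cofactor k = 0 := by
    rw [← genMap_apply_coe, hr]; rfl
  obtain ⟨s, hs, -⟩ := (sum_mul_cofactor_eq_zero_iff r).1 h0
  rw [tupleMap_apply]
  refine Finset.sum_eq_zero fun k _ => ?_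
  rw [hs k, mul_comm, mul_smul, hν k, smul_zero]

/-- The `R`-linear map `I_W → R/I_W` with PRESCRIBED generator values `ν` (any tuple killed by the `x_k`). -/
noncomputable def homOfTuple [IsDomain K] (ν : Fin n → MvPolynomial (Fin n) K ⧸ srDesignIdeal K n)
    (hν : ∀ k, (X k : MvPolynomial (Fin n) K) • ν k = 0) :
    srDesignIdeal K n →ₗ[MvPolynomial (Fin n) K] MvPolynomial (Fin n) K ⧸ srDesignIdeal K n :=
  ((LinearMap.ker genMap).liftQ (tupleMap ν) (ker_genMap_le_ker_tupleMap hν)) ∘ₗ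
    (genMap.quotKerEquivOfSurjective genMap_surjective).symm.toLinearMap

/-- `homOfTuple ν` takes the value `ν_k` at `m_k`. -/
theorem homOfTuple_gen [IsDomain K] (ν : Fin n → MvPolynomial (Fin n) K ⧸ srDesignIdeal K n)
    (hν : ∀ k, (X k : MvPolynomial (Fin n) K) • ν k = 0) (k : Fin n) :
    homOfTuple ν hν ⟨cofactor k, cofactor_mem k⟩ = ν k := by
  rw [homOfTuple, LinearMap.comp_apply, LinearEquiv.coe_toLinearMap, ← genMap_single,
    LinearMap.quotKerEquivOfSurjective_symm_apply, Submodule.liftQ_apply, tupleMap_apply,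
    Finset.sum_eq_single k]
  · simp
  · intro l _ hl; simp [hl]
  · intro h; exact absurd (mem_univ k) h

/-- For ANY `R`-linear `φ : I_W → R/I_W`: `x_j φ(m_j) = x_k φ(m_k)` (both are `φ(x_1 ⋯ x_n)`). -/
theorem X_smul_apply_gen_eq (φ : srDesignIdeal K n →ₗ[MvPolynomial (Fin n) K]
    MvPolynomial (Fin n) K ⧸ srDesignIdeal K n) (j k : Fin n) :
    (X j : MvPolynomial (Fin n) K) • φ ⟨cofactor j, cofactor_mem j⟩
      = (X k : MvPolynomial (Fin n) K) • φ ⟨cofactor k, cofactor_mem k⟩ := by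
  rw [← map_smul, ← map_smul]
  congr 1
  apply Subtype.ext
  change X j * cofactor j = X k * cofactor k
  rw [X_mul_cofactor, X_mul_cofactor]

/-- Hence (step A) `x_k φ(m_k) = 0` for every `k` and every `φ`. -/
theorem X_smul_apply_gen_eq_zero (φ : srDesignIdeal K n →ₗ[MvPolynomial (Fin n) K]
    MvPolynomial (Fin n) K ⧸ srDesignIdeal K n) (k : Fin n) :
    (X k : MvPolynomial (Fin n) K) • φ ⟨cofactor k, cofactor_mem k⟩ = 0 :=
  X_smul_eq_zero_of_forall_X_smul_eq _ (X_smul_apply_gen_eq φ) k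

/-- An `R`-linear map out of `I_W` is determined by its generator values. -/
theorem hom_ext_gen {φ ψ : srDesignIdeal K n →ₗ[MvPolynomial (Fin n) K]
    MvPolynomial (Fin n) K ⧸ srDesignIdeal K n}
    (h : ∀ k, φ ⟨cofactor k, cofactor_mem k⟩ = ψ ⟨cofactor k, cofactor_mem k⟩) : φ = ψ := by
  apply LinearMap.ext
  intro x
  obtain ⟨r, rfl⟩ := genMap_surjective x
  simp only [genMap, LinearMap.sum_apply, LinearMap.smulRight_apply, LinearMap.proj_apply, map_sum,
    map_smul, h]

variable (K n) in
/-- The tuples `ν ∈ (R/I_W)ⁿ` killed coordinatewise by the `x_k`: `⊕_k Ann_{R/I_W}(x_k)`. -/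
noncomputable def annTuples :
    Submodule (MvPolynomial (Fin n) K) (Fin n → MvPolynomial (Fin n) K ⧸ srDesignIdeal K n) where
  carrier := {ν | ∀ k, (X k : MvPolynomial (Fin n) K) • ν k = 0}
  add_mem' {ν μ} hν hμ k := by simp only [Pi.add_apply, smul_add, hν k, hμ k, add_zero]
  zero_mem' k := by simp
  smul_mem' c {ν} hν k := by
    simp only [Pi.smul_apply]
    rw [smul_comm, hν k, smul_zero]

/-- Membership in `annTuples`. -/
theorem mem_annTuples {ν : Fin n → MvPolynomial (Fin n) K ⧸ srDesignIdeal K n} :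
    ν ∈ annTuples K n ↔ ∀ k, (X k : MvPolynomial (Fin n) K) • ν k = 0 := Iff.rfl

variable (K n) in
/-- **L1 (i), first half (every `n`, every domain `K`).**  Evaluation at the generators `m_k` is an `R`-linear ISOMORPHISM
`Hom_R(I_W, R/I_W) ≃ {ν ∈ (R/I_W)ⁿ : x_k ν_k = 0 ∀ k} = ⊕_k Ann_{R/I_W}(x_k)` — the «normal module» of the SR design is
the module of generator-value tuples killed by the coordinates (printed form: «`Hom(I, N) = {ν ∈ Nⁿ : x_1 ν_1 = x_k ν_k}`
by (pd)», and for `N = R/I` the common value is `0`). -/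
noncomputable def evalGenEquiv [IsDomain K] :
    (srDesignIdeal K n →ₗ[MvPolynomial (Fin n) K] MvPolynomial (Fin n) K ⧸ srDesignIdeal K n)
      ≃ₗ[MvPolynomial (Fin n) K] annTuples K n where
  toFun φ := ⟨fun k => φ ⟨cofactor k, cofactor_mem k⟩, fun k => X_smul_apply_gen_eq_zero φ k⟩
  map_add' _ _ := rfl
  map_smul' _ _ := rfl
  invFun ν := homOfTuple ν.1 ν.2
  left_inv _ := hom_ext_gen fun k => homOfTuple_gen _ _ k
  right_inv _ := Subtype.ext (funext fun k => homOfTuple_gen _ _ k)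

/-- The isomorphism evaluates at the generators. -/
theorem evalGenEquiv_apply [IsDomain K] (φ : srDesignIdeal K n →ₗ[MvPolynomial (Fin n) K]
    MvPolynomial (Fin n) K ⧸ srDesignIdeal K n) (k : Fin n) :
    (evalGenEquiv K n φ : Fin n → _) k = φ ⟨cofactor k, cofactor_mem k⟩ := rfl

end Summit.Ventures.HSemireg.ObstructionLocus
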